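import Literature.AlgebraicGeometry.AbelianSchemes.RigidifiedLineBundleTensor
import Literature.AlgebraicGeometry.AbelianSchemes.AbelianSchemeOverRigidity
import HarnessLib

/-!
# The Poincaré sheaf is multiplicative in `Â`: `(1_A × g₁g₂)^*𝒫 ≅ (1_A × g₁)^*𝒫 ⊗ (1_A × g₂)^*𝒫` — the group law of the
# dual abelian scheme is the tensor product of rigidified `Pic⁰` families

Layer `Literature/AlgebraicGeometry/AbelianSchemes`, namespace `Literature.AlgebraicGeometry.AbelianSchemes.AbelianSchemeOver`.
Cell `hodgecm-mathlib`, HECKE-LINK brick H2 file (ii), input **(P-⊗)** of the universality theorem D6 ((u2)/(u3)) and of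
the counting `#K′ = n^{2g}/#K` (census `B-provers/B-p20/g9/CENSUS-H2-DualPairOfQuotient.B-p20g9.md`); part 2 over part 1
★ `RigidifiedLineBundleTensor`.

THE POINT.  The tree's ★ `DualPair` ([MilneAV2008, I §8] as an interface: `hat`, `P`, rank one, the normalisation `rigid`
along `ε_A × 1_Â`, `fibrewisePicZero`, `universal`) does NOT tie the GROUP LAW of `hat` to `𝒫`: translating the law of
`Â` by any section gives another instance with the same `P`.  What ties them is the unit hypothesis
`hD : 𝒫|_{A × {ε_Â}} ≅ 𝒪` (the binder of ★ `AbelianSchemeDualTransport`, discharged from a polarisation by ★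
`AbelianSchemeDualTransportUnit`), and under `hD` the identification is FORCED by rigidity: over a reduced locally
Noetherian base `S`, the `S`-morphism `m′ : Â ×_S Â → Â` classifying the rigidified fibrewise-`Pic⁰` family
`(1_A × pr₁)^*𝒫 ⊗ (1_A × pr₂)^*𝒫` on `A_{Â ×_S Â}` sends `(ε, ε)` to `ε` (by `hD`), hence is a homomorphism of abelian
schemes ([MumfordFogartyKirwan1994] Cor. 6.4, ★ `isMonHom_of_one_comp_of_isReduced_base`, applied to the PRODUCT abelian
scheme `Â ×_S Â` — Mathlib's `GrpObj` structure on `Â ⊗ Â` in the cartesian monoidal `Over S`), and restricts to the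
identity on both axes (`𝒫 ⊗ 𝒪 ≅ 𝒫`), so `m′ = pr₁ · pr₂` is the group law.  This is [MumfordAV1970, §8 (p. 75) / §13]
«`Â(k) → Pic⁰(A)` is a homomorphism» over a base, in the only form the abstract interface can carry.

* §1 `GrpObj` plumbing in a cartesian monoidal category: the product abelian scheme `Â ×_S Â` (`isProper_tensorObj_hom`,
  `smooth_tensorObj_hom`, `geometricallyConnected_tensorObj_hom`) and `eq_fst_mul_snd_of_isMonHom` (a homomorphism
  `B × B → B` which is the identity on both axes is the multiplication).
* §2 the family `𝒫_{pr₁} ⊗ 𝒫_{pr₂}` restricted along `u : T → Â ×_S Â` is `𝒫_{u₁} ⊗ 𝒫_{u₂}`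
  (`nonempty_comap_tensor_iso`); its classifying morphism kills the unit (`unit_comp_classify_tensor`), is the identity on
  the axes (`inl_comp_classify_tensor`, `inr_comp_classify_tensor`) and IS THE GROUP LAW (`classify_tensor_eq_mul`).
* §3 **`DualPair.nonempty_pullbackP_mul_iso`** — for `S` reduced and locally Noetherian, `hD`, any `f : T → S` and any two
  `T`-valued points `g₁, g₂ : T → Â` over `S`: `(1_A × g₁g₂)^*𝒫 ≅ (1_A × g₁)^*𝒫 ⊗ (1_A × g₂)^*𝒫` on `A_T` (no hypothesis
  on `T`).

Theorems only (no def, no instance, no named fact, no sorry).  HC_CM is proved only modulo the 7 printed citations until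
rung 0 closes; nothing here is about HC.

## References
* [MumfordAV1970] D. Mumford, *Abelian Varieties* (1970), §8 (pp. 74–75: `Pic⁰`, and `x ↦ T_x^*L ⊗ L⁻¹` a homomorphism),
  §13 (p. 125: the dual and the Poincaré bundle).
* [MilneAV2008] J. S. Milne, *Abelian Varieties* (v2.00, 2008), I §8 pp. 36–37.
* [MumfordFogartyKirwan1994] D. Mumford, J. Fogarty, F. Kirwan, *Geometric Invariant Theory*, 3rd ed. (1994), Ch. 6 §1
  Cor. 6.4 (p. 117).
-/

noncomputable section

universe u

open CategoryTheory CategoryTheory.Limits AlgebraicGeometry MonoidalCategory CartesianMonoidalCategory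
open scoped MonObj

-- `Scheme.Modules` / `SheafOfModules` are not reducible (as in Mathlib's `AlgebraicGeometry/Modules/Sheaf.lean`).
set_option backward.isDefEq.respectTransparency false

namespace Literature.AlgebraicGeometry.AbelianSchemes

namespace AbelianSchemeOver

open Literature.AlgebraicGeometry.Motives Literature.AlgebraicGeometry.AbelianVarieties
  Literature.AlgebraicGeometry.Modules

variable {S : Scheme.{u}} (B : AbelianSchemeOver S)

/-! ## §1 The product abelian scheme `B ×_S B` and homomorphisms out of it -/

/-- `B ×_S B → S` is proper. [cite: MumfordFogartyKirwan1994, Ch. 6 §1 Definition 6.1 (p. 115)] -/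
theorem isProper_tensorObj_hom : IsProper (B.X ⊗ B.X).hom := by
  haveI := B.isProper
  change IsProper (pullback.fst B.X.hom B.X.hom ≫ B.X.hom)
  infer_instance

/-- `B ×_S B → S` is smooth. [cite: MumfordFogartyKirwan1994, Ch. 6 §1 Definition 6.1 (p. 115)] -/
theorem smooth_tensorObj_hom : Smooth (B.X ⊗ B.X).hom := by
  haveI := B.isSmooth
  change Smooth (pullback.fst B.X.hom B.X.hom ≫ B.X.hom)
  infer_instance

/-- `B ×_S B → S` has geometrically connected fibres (Mathlib `GeometricallyConnected.comp` for universally open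
morphisms; smooth morphisms are universally open, ★ `universallyOpen_hom`).
[cite: MumfordFogartyKirwan1994, Ch. 6 §1 Definition 6.1 (p. 115)] -/
theorem geometricallyConnected_tensorObj_hom : GeometricallyConnected (B.X ⊗ B.X).hom := by
  haveI := B.isSmooth
  haveI := B.geometricallyConnected
  haveI : UniversallyOpen B.X.hom := B.universallyOpen_hom
  change GeometricallyConnected (pullback.fst B.X.hom B.X.hom ≫ B.X.hom)
  exact GeometricallyConnected.comp _ _

/-- In a cartesian monoidal category, `(x, y) = (x, e) · (e, y)` in the product group `B × B`:
`(pr₁ ≫ ι₁) · (pr₂ ≫ ι₂) = 𝟙` for the axes `ι₁ = (𝟙, e)`, `ι₂ = (e, 𝟙)` (the projections are homomorphisms for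
Mathlib's product group structure). [cite: MumfordFogartyKirwan1994, Ch. 6 §1 Corollary 6.4 (p. 117)] -/
theorem fst_inl_mul_snd_inr :
    (fst B.X B.X ≫ lift (𝟙 B.X) (toUnit _ ≫ η[B.X])) * (snd B.X B.X ≫ lift (toUnit _ ≫ η[B.X]) (𝟙 B.X)) =
      𝟙 (B.X ⊗ B.X) := by
  have h1 : ∀ {Y : Over S} (a : Y ⟶ B.X), a * (toUnit Y ≫ η[B.X]) = a := fun a => mul_one a
  have h2 : ∀ {Y : Over S} (a : Y ⟶ B.X), (toUnit Y ≫ η[B.X]) * a = a := fun a => one_mul a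
  apply CartesianMonoidalCategory.hom_ext
  · rw [MonObj.mul_comp, Category.assoc, lift_fst, Category.assoc, lift_fst, Category.comp_id, Category.id_comp,
      ← Category.assoc, comp_toUnit, h1]
  · rw [MonObj.mul_comp, Category.assoc, lift_snd, Category.assoc, lift_snd, Category.comp_id, Category.id_comp,
      ← Category.assoc, comp_toUnit, h2]

/-- **A homomorphism `B × B → B` which is the identity on both axes is the multiplication `pr₁ · pr₂`.**
[cite: MumfordFogartyKirwan1994, Ch. 6 §1 Corollary 6.4 (p. 117)] -/
theorem eq_fst_mul_snd_of_isMonHom (h : B.X ⊗ B.X ⟶ B.X) [IsMonHom h]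
    (h₁ : lift (𝟙 B.X) (toUnit _ ≫ η[B.X]) ≫ h = 𝟙 B.X) (h₂ : lift (toUnit _ ≫ η[B.X]) (𝟙 B.X) ≫ h = 𝟙 B.X) :
    h = fst B.X B.X * snd B.X B.X := by
  calc h = ((fst B.X B.X ≫ lift (𝟙 B.X) (toUnit _ ≫ η[B.X])) * (snd B.X B.X ≫ lift (toUnit _ ≫ η[B.X]) (𝟙 B.X))) ≫ h := by
        rw [fst_inl_mul_snd_inr, Category.id_comp]
    _ = fst B.X B.X * snd B.X B.X := by
        rw [MonObj.mul_comp, Category.assoc, h₁, Category.assoc, h₂, Category.comp_id, Category.comp_id]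

variable {B} {A : AbelianSchemeOver S}

namespace DualPair

variable (D : A.DualPair)

/-! ## §2 The family `𝒫_{pr₁} ⊗ 𝒫_{pr₂}` on `A_{Â ×_S Â}` and its classifying morphism -/

/-- **`(𝒫_{pr₁} ⊗ 𝒫_{pr₂})|_u ≅ 𝒫_{u₁} ⊗ 𝒫_{u₂}`**: the restriction along `1_A × u`, `u : T → Â ×_S Â`, of the tensor
family is the tensor product of the families classified by the two coordinates `u₁ = u ≫ pr₁`, `u₂ = u ≫ pr₂`
(★ `pullbackTensorIso`, ★ `restrictLeft_comp_baseChangeToProd`). [cite: MilneAV2008, I §8 pp. 36–37] -/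
theorem nonempty_pullback_restrictLeft_tensor_iso {T : Scheme.{u}} (u : T ⟶ (D.hat.X ⊗ D.hat.X).left) :
    Nonempty ((Scheme.Modules.pullback (A.restrictLeft (D.hat.X ⊗ D.hat.X).hom u)).obj
        (tensorObj (D.pullbackP (D.hat.X ⊗ D.hat.X).hom (fst D.hat.X D.hat.X).left (Over.w _))
          (D.pullbackP (D.hat.X ⊗ D.hat.X).hom (snd D.hat.X D.hat.X).left (Over.w _))) ≅
      tensorObj (D.pullbackP (u ≫ (D.hat.X ⊗ D.hat.X).hom) (u ≫ (fst D.hat.X D.hat.X).left)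
          (by rw [Category.assoc, Over.w]))
        (D.pullbackP (u ≫ (D.hat.X ⊗ D.hat.X).hom) (u ≫ (snd D.hat.X D.hat.X).left)
          (by rw [Category.assoc, Over.w]))) := by
  refine ⟨pullbackTensorIso _ (HasRank.isFiniteLocallyFree' (D.hasRank_one_pullbackP _ _ (Over.w _)))
      (HasRank.isFiniteLocallyFree' (D.hasRank_one_pullbackP _ _ (Over.w _))) ≪≫ tensorMapIso ?_ ?_⟩
  · exact (Scheme.Modules.pullbackComp _ _).app D.P ≪≫
      (Scheme.Modules.pullbackCongr (A.restrictLeft_comp_baseChangeToProd _ u D.hat _ (Over.w _))).app D.P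
  · exact (Scheme.Modules.pullbackComp _ _).app D.P ≪≫
      (Scheme.Modules.pullbackCongr (A.restrictLeft_comp_baseChangeToProd _ u D.hat _ (Over.w _))).app D.P

/-- **The classifying morphism of `𝒫_{pr₁} ⊗ 𝒫_{pr₂}` and its uniqueness along restrictions**: there is an `S`-morphism
`m′ : Â ×_S Â → Â` with `(1_A × m′)^*𝒫 ≅ 𝒫_{pr₁} ⊗ 𝒫_{pr₂}`, and for every `u : T → Â ×_S Â` the composite `u ≫ m′` is
the ONLY `S`-morphism `g : T → Â` with `(1_A × g)^*𝒫 ≅ 𝒫_{u₁} ⊗ 𝒫_{u₂}` (★ `universal` for the tensor family, which is a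
rigidified fibrewise-`Pic⁰` family by ★ `RigidifiedLineBundleTensor`; ★ `classify_comap`).
[cite: MilneAV2008, I §8 pp. 36–37] -/
theorem exists_classify_tensor :
    ∃ (m : (D.hat.X ⊗ D.hat.X).left ⟶ D.hat.X.left) (hm : m ≫ D.hat.X.hom = (D.hat.X ⊗ D.hat.X).hom),
      Nonempty (D.pullbackP _ m hm ≅
        tensorObj (D.pullbackP (D.hat.X ⊗ D.hat.X).hom (fst D.hat.X D.hat.X).left (Over.w _))
          (D.pullbackP (D.hat.X ⊗ D.hat.X).hom (snd D.hat.X D.hat.X).left (Over.w _))) ∧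
      ∀ {T : Scheme.{u}} (u : T ⟶ (D.hat.X ⊗ D.hat.X).left) (g : T ⟶ D.hat.X.left)
        (hg : g ≫ D.hat.X.hom = u ≫ (D.hat.X ⊗ D.hat.X).hom),
        Nonempty (D.pullbackP _ g hg ≅
          tensorObj (D.pullbackP (u ≫ (D.hat.X ⊗ D.hat.X).hom) (u ≫ (fst D.hat.X D.hat.X).left)
              (by rw [Category.assoc, Over.w]))
            (D.pullbackP (u ≫ (D.hat.X ⊗ D.hat.X).hom) (u ≫ (snd D.hat.X D.hat.X).left)
              (by rw [Category.assoc, Over.w]))) →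
        g = u ≫ m := by
  -- the two coordinate families and their tensor product, as rigidified fibrewise-`Pic⁰` families on `A_{Â ×_S Â}`
  obtain ⟨ℒ₁, hℒ₁, h₁⟩ : ∃ ℒ : A.RigidifiedLineBundle (D.hat.X ⊗ D.hat.X).hom,
      ℒ.L = D.pullbackP (D.hat.X ⊗ D.hat.X).hom (fst D.hat.X D.hat.X).left (Over.w _) ∧ ℒ.FibrewisePicZero :=
    ⟨_, rfl, D.fibrewisePicZero_pullbackP _ _ (Over.w _)⟩
  obtain ⟨ℒ₂, hℒ₂, h₂⟩ : ∃ ℒ : A.RigidifiedLineBundle (D.hat.X ⊗ D.hat.X).hom,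
      ℒ.L = D.pullbackP (D.hat.X ⊗ D.hat.X).hom (snd D.hat.X D.hat.X).left (Over.w _) ∧ ℒ.FibrewisePicZero :=
    ⟨_, rfl, D.fibrewisePicZero_pullbackP _ _ (Over.w _)⟩
  obtain ⟨𝒬, h𝒬, h₀⟩ : ∃ 𝒬 : A.RigidifiedLineBundle (D.hat.X ⊗ D.hat.X).hom,
      𝒬.L = tensorObj ℒ₁.L ℒ₂.L ∧ 𝒬.FibrewisePicZero :=
    ⟨_, rfl, RigidifiedLineBundle.fibrewisePicZero_tensorObj ℒ₁ ℒ₂ h₁ h₂⟩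
  rw [hℒ₁, hℒ₂] at h𝒬
  refine ⟨D.classify _ 𝒬 h₀, D.classify_comp_hom _ 𝒬 h₀,
    (D.nonempty_pullbackP_classify_iso _ 𝒬 h₀).map fun i => i ≪≫ eqToIso h𝒬, fun u g hg hN => ?_⟩
  rw [← D.classify_comap u 𝒬 h₀]
  refine D.eq_classify _ (𝒬.comap u) (h₀.comap u) g hg ?_
  obtain ⟨i⟩ := hN
  obtain ⟨j⟩ := D.nonempty_pullback_restrictLeft_tensor_iso u
  exact ⟨i ≪≫ j.symm ≪≫ ((Scheme.Modules.pullback _).mapIso (eqToIso h𝒬)).symm ≪≫ (𝒬.comapLIso u).symm⟩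

variable [IsReduced S] [IsLocallyNoetherian S]

/-- **THE CLASSIFYING MORPHISM OF `𝒫_{pr₁} ⊗ 𝒫_{pr₂}` IS THE GROUP LAW `pr₁ · pr₂ : Â ×_S Â → Â`** (reduced locally
Noetherian base, unit hypothesis `hD`): `(1_A × pr₁pr₂)^*𝒫 ≅ (1_A × pr₁)^*𝒫 ⊗ (1_A × pr₂)^*𝒫` on `A_{Â ×_S Â}`.  Proof:
the classifying `m′` (i) kills the unit — along `u = (ε, ε)` both coordinate families are `(1_A × ε)^*𝒫 ≅ 𝒪` by `hD`, and
`ε` classifies `𝒪 ⊗ 𝒪 ≅ 𝒪`; (ii) is therefore a homomorphism of the abelian schemes `Â ×_S Â → Â`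
([MumfordFogartyKirwan1994] Cor. 6.4, ★ `isMonHom_of_one_comp_of_isReduced_base`); (iii) is the identity on the axes
`(𝟙, ε)`, `(ε, 𝟙)` (`𝒫 ⊗ 𝒪 ≅ 𝒫`); hence (iv) `m′ = pr₁ · pr₂` (§1).
[cite: MumfordAV1970, §8 (pp. 74–75) and §13 (p. 125)] [cite: MumfordFogartyKirwan1994, Ch. 6 §1 Corollary 6.4 (p. 117)] -/
theorem nonempty_pullbackP_fst_mul_snd_iso_tensor
    (hD : Nonempty ((Scheme.Modules.pullback (unitHatSlice D)).obj D.P ≅ SheafOfModules.unit _)) :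
    Nonempty (D.pullbackP (D.hat.X ⊗ D.hat.X).hom (fst D.hat.X D.hat.X * snd D.hat.X D.hat.X).left (Over.w _) ≅
      tensorObj (D.pullbackP (D.hat.X ⊗ D.hat.X).hom (fst D.hat.X D.hat.X).left (Over.w _))
        (D.pullbackP (D.hat.X ⊗ D.hat.X).hom (snd D.hat.X D.hat.X).left (Over.w _))) := by
  obtain ⟨m, hm, hiso, huniq⟩ := D.exists_classify_tensor
  -- `𝒪 ⊗`-absorption of the unit coordinate: `(1_A × (f ≫ ε))^*𝒫 ≅ 𝒪`
  have hunit : ∀ {T : Scheme.{u}} (f : T ⟶ S) (g : T ⟶ D.hat.X.left) (hg : g ≫ D.hat.X.hom = f),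
      g = f ≫ D.hat.unitSection → Nonempty (D.pullbackP f g hg ≅ SheafOfModules.unit _) := by
    intro T f g hg hgf
    have hf : (f ≫ D.hat.unitSection) ≫ D.hat.X.hom = f := by rw [Category.assoc, D.hat.unitSection_comp_hom, Category.comp_id]
    rw [D.pullbackP_congr f hgf hg hf]
    exact D.nonempty_pullbackP_comp_unitSection_iso f hD hf
  -- (i) `m′` kills the unit
  have hone : (η[D.hat.X ⊗ D.hat.X]).left ≫ m = (η[D.hat.X]).left := by
    have hu : (η[D.hat.X ⊗ D.hat.X]).left ≫ (D.hat.X ⊗ D.hat.X).hom = 𝟙 S := Over.w _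
    have key := huniq (η[D.hat.X ⊗ D.hat.X]).left ((η[D.hat.X ⊗ D.hat.X]).left ≫ (D.hat.X ⊗ D.hat.X).hom ≫ D.hat.unitSection)
      (by rw [Category.assoc, Category.assoc, D.hat.unitSection_comp_hom, Category.comp_id]) ?_
    · rw [← key, ← Category.assoc, hu]; exact Category.id_comp _
    obtain ⟨e₀⟩ := hunit _ ((η[D.hat.X ⊗ D.hat.X]).left ≫ (D.hat.X ⊗ D.hat.X).hom ≫ D.hat.unitSection)
      (by rw [Category.assoc, Category.assoc, D.hat.unitSection_comp_hom, Category.comp_id]) rfl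
    obtain ⟨e₁⟩ := hunit _ ((η[D.hat.X ⊗ D.hat.X]).left ≫ (fst D.hat.X D.hat.X).left)
      (by rw [Category.assoc, Over.w]) (by rw [← Over.comp_left, IsMonHom.one_hom, hu]; exact (Category.id_comp _).symm)
    obtain ⟨e₂⟩ := hunit _ ((η[D.hat.X ⊗ D.hat.X]).left ≫ (snd D.hat.X D.hat.X).left)
      (by rw [Category.assoc, Over.w]) (by rw [← Over.comp_left, IsMonHom.one_hom, hu]; exact (Category.id_comp _).symm)
    exact ⟨e₀ ≪≫ (tensorUnitLeftIso _).symm ≪≫ (tensorMapIso e₁ e₂).symm⟩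
  -- (iii) `m′` is the identity on the two axes
  have hinl : (lift (𝟙 D.hat.X) (toUnit _ ≫ η[D.hat.X])).left ≫ m = 𝟙 _ := by
    have hu : (lift (𝟙 D.hat.X) (toUnit _ ≫ η[D.hat.X])).left ≫ (D.hat.X ⊗ D.hat.X).hom = D.hat.X.hom := Over.w _
    have h1 : (lift (𝟙 D.hat.X) (toUnit _ ≫ η[D.hat.X])).left ≫ (fst D.hat.X D.hat.X).left = 𝟙 _ := by
      rw [← Over.comp_left, lift_fst]; rfl
    have key := huniq (lift (𝟙 D.hat.X) (toUnit _ ≫ η[D.hat.X])).left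
      ((lift (𝟙 D.hat.X) (toUnit _ ≫ η[D.hat.X])).left ≫ (fst D.hat.X D.hat.X).left) (by rw [Category.assoc, Over.w]) ?_
    · rw [← key, h1]
    obtain ⟨e₂⟩ := hunit _ ((lift (𝟙 D.hat.X) (toUnit _ ≫ η[D.hat.X])).left ≫ (snd D.hat.X D.hat.X).left)
      (by rw [Category.assoc, Over.w])
      (by rw [← Over.comp_left, lift_snd, Over.comp_left, Over.toUnit_left, hu])
    exact ⟨(tensorUnitRightIso _).symm ≪≫ (tensorMapIso (Iso.refl _) e₂).symm⟩
  have hinr : (lift (toUnit _ ≫ η[D.hat.X]) (𝟙 D.hat.X)).left ≫ m = 𝟙 _ := by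
    have hu : (lift (toUnit _ ≫ η[D.hat.X]) (𝟙 D.hat.X)).left ≫ (D.hat.X ⊗ D.hat.X).hom = D.hat.X.hom := Over.w _
    have h2 : (lift (toUnit _ ≫ η[D.hat.X]) (𝟙 D.hat.X)).left ≫ (snd D.hat.X D.hat.X).left = 𝟙 _ := by
      rw [← Over.comp_left, lift_snd]; rfl
    have key := huniq (lift (toUnit _ ≫ η[D.hat.X]) (𝟙 D.hat.X)).left
      ((lift (toUnit _ ≫ η[D.hat.X]) (𝟙 D.hat.X)).left ≫ (snd D.hat.X D.hat.X).left) (by rw [Category.assoc, Over.w]) ?_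
    · rw [← key, h2]
    obtain ⟨e₁⟩ := hunit _ ((lift (toUnit _ ≫ η[D.hat.X]) (𝟙 D.hat.X)).left ≫ (fst D.hat.X D.hat.X).left)
      (by rw [Category.assoc, Over.w])
      (by rw [← Over.comp_left, lift_fst, Over.comp_left, Over.toUnit_left, hu])
    exact ⟨(tensorUnitLeftIso _).symm ≪≫ (tensorMapIso e₁ (Iso.refl _)).symm⟩
  -- (ii) + (iv): `m′` is a homomorphism `Â ×_S Â → Â` of abelian schemes, hence the multiplication
  let P2 : AbelianSchemeOver S :=
    { X := D.hat.X ⊗ D.hat.X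
      isProper := isProper_tensorObj_hom D.hat
      isSmooth := smooth_tensorObj_hom D.hat
      geometricallyConnected := geometricallyConnected_tensorObj_hom D.hat }
  let M : P2.X ⟶ D.hat.X := Over.homMk m hm
  haveI : IsMonHom M := isMonHom_of_one_comp_of_isReduced_base (A := P2) (B := D.hat) M (Over.OverMorphism.ext hone)
  have hM : M = fst D.hat.X D.hat.X * snd D.hat.X D.hat.X :=
    eq_fst_mul_snd_of_isMonHom D.hat M (Over.OverMorphism.ext hinl) (Over.OverMorphism.ext hinr)
  have hm' : m = (fst D.hat.X D.hat.X * snd D.hat.X D.hat.X).left := by rw [← hM]; rfl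
  rw [← D.pullbackP_congr _ hm' hm]
  exact hiso

/-! ## §3 `(1_A × g₁g₂)^*𝒫 ≅ (1_A × g₁)^*𝒫 ⊗ (1_A × g₂)^*𝒫` for `T`-valued points -/

/-- **THE GROUP LAW OF `Â` IS THE TENSOR PRODUCT OF FAMILIES** ([MumfordAV1970, §8]: `Â → Pic⁰(A)` is a homomorphism,
over a base): for `S` reduced and locally Noetherian, a dual pair `D = (Â, 𝒫)` of `A/S` satisfying the unit hypothesis
`𝒫|_{A × {ε_Â}} ≅ 𝒪`, any `f : T → S` and any two `T`-valued points `g₁, g₂ : T → Â` over `S` (as morphisms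
`Over.mk f ⟶ Â` in `Over S`, multiplied by the group law of `Â`):
`(1_A × g₁g₂)^*𝒫 ≅ (1_A × g₁)^*𝒫 ⊗ (1_A × g₂)^*𝒫` on `A_T` — the pull-back along `1_A × (g₁, g₂) : A_T → A_{Â ×_S Â}` of
§2 (no hypothesis on `T`). [cite: MumfordAV1970, §8 (pp. 74–75) and §13 (p. 125)] [cite: MilneAV2008, I §8 pp. 36–37] -/
theorem nonempty_pullbackP_mul_iso
    (hD : Nonempty ((Scheme.Modules.pullback (unitHatSlice D)).obj D.P ≅ SheafOfModules.unit _))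
    {T : Scheme.{u}} (f : T ⟶ S) (g₁ g₂ : Over.mk f ⟶ D.hat.X) :
    Nonempty (D.pullbackP f (g₁ * g₂).left (Over.w _) ≅
      tensorObj (D.pullbackP f g₁.left (Over.w g₁)) (D.pullbackP f g₂.left (Over.w g₂))) := by
  obtain ⟨I⟩ := D.nonempty_pullbackP_fst_mul_snd_iso_tensor hD
  -- `1_A × (g₁, g₂) : A_T → A_{Â ×_S Â}`
  have hu : (lift g₁ g₂).left ≫ (D.hat.X ⊗ D.hat.X).hom = f := Over.w _
  obtain ⟨r, hr₁, hr₂⟩ : ∃ r : (A.baseChange f).left ⟶ (A.baseChange (D.hat.X ⊗ D.hat.X).hom).left,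
      r ≫ pullback.fst _ _ = pullback.fst _ _ ∧ r ≫ pullback.snd _ _ = pullback.snd _ _ ≫ (lift g₁ g₂).left :=
    ⟨pullback.lift (pullback.fst _ _) (pullback.snd _ _ ≫ (lift g₁ g₂).left)
      (by rw [pullback.condition, Category.assoc, hu]), pullback.lift_fst _ _ _, pullback.lift_snd _ _ _⟩
  have hr : ∀ (g : (D.hat.X ⊗ D.hat.X).left ⟶ D.hat.X.left) (hg : g ≫ D.hat.X.hom = (D.hat.X ⊗ D.hat.X).hom),
      r ≫ A.baseChangeToProd D.hat _ g hg =
        A.baseChangeToProd D.hat f ((lift g₁ g₂).left ≫ g) (by rw [Category.assoc, hg, hu]) := by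
    intro g hg
    apply pullback.hom_ext
    · rw [Category.assoc, baseChangeToProd_fst, baseChangeToProd_fst, hr₁]
    · rw [Category.assoc, baseChangeToProd_snd, baseChangeToProd_snd, ← Category.assoc, hr₂, Category.assoc]
  -- `(1_A × (g₁,g₂))^* (1_A × g)^* 𝒫 ≅ (1_A × ((g₁,g₂) ≫ g))^* 𝒫`
  have e : ∀ (g : (D.hat.X ⊗ D.hat.X).left ⟶ D.hat.X.left) (hg : g ≫ D.hat.X.hom = (D.hat.X ⊗ D.hat.X).hom),
      (Scheme.Modules.pullback r).obj (D.pullbackP _ g hg) ≅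
        D.pullbackP f ((lift g₁ g₂).left ≫ g) (by rw [Category.assoc, hg, hu]) := fun g hg =>
    (Scheme.Modules.pullbackComp _ _).app D.P ≪≫ (Scheme.Modules.pullbackCongr (hr g hg)).app D.P
  have h12 : (lift g₁ g₂).left ≫ (fst D.hat.X D.hat.X * snd D.hat.X D.hat.X).left = (g₁ * g₂).left := by
    rw [← Over.comp_left, MonObj.comp_mul, lift_fst, lift_snd]
  have h1 : (lift g₁ g₂).left ≫ (fst D.hat.X D.hat.X).left = g₁.left := by rw [← Over.comp_left, lift_fst]
  have h2 : (lift g₁ g₂).left ≫ (snd D.hat.X D.hat.X).left = g₂.left := by rw [← Over.comp_left, lift_snd]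
  refine ⟨?_⟩
  rw [← D.pullbackP_congr f h12 (by rw [Category.assoc, Over.w, hu]) (Over.w _),
    ← D.pullbackP_congr f h1 (by rw [Category.assoc, Over.w, hu]) (Over.w g₁),
    ← D.pullbackP_congr f h2 (by rw [Category.assoc, Over.w, hu]) (Over.w g₂)]
  exact (e _ (Over.w _)).symm ≪≫ (Scheme.Modules.pullback r).mapIso I ≪≫
    pullbackTensorIso r (HasRank.isFiniteLocallyFree' (D.hasRank_one_pullbackP _ _ (Over.w _)))
      (HasRank.isFiniteLocallyFree' (D.hasRank_one_pullbackP _ _ (Over.w _))) ≪≫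
    tensorMapIso (e _ (Over.w _)) (e _ (Over.w _))

end DualPair

end AbelianSchemeOver

end Literature.AlgebraicGeometry.AbelianSchemes

end
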